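import Summits.QuantumFields.YangMills.Theorems.BalabanUVNodesK1AxV11Defs
import Summits.QuantumFields.YangMills.Theorems.BalabanUVNodesK1R9BodyAtRevisedRecordWorldOfNodesWRunLetters  -- the R1W END-along-runs lemma, landed verbatim by this seat (g12) for K1⁹ v10 — cited, not restated (gate `dedup.landed`)

/-!
# K1ᴬ v11.1 — THE TREE MIRROR OF THE REGISTERED SKELETON's KERNEL ROADS AND HYPOTHESIS-FORM COMPOSITIONS (`K1Skeleton13SepCoPHAxV11_1.lean` 1c0150ff21ca0f8d (v11.1, registered 2026-08-31T05:52:57Z), lines :264–:293, :345–:374, :545–:710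
# minus the stubs and the two by-name concluders, and minus `endStatementBPrinted_of_nodesPW_alongRuns_partialSums` :545 which IS this seat's landed g12 lemma — cited) over `…K1AxV11Defs`: LINE 1's annexes `StabilityBAtRecordR13SepCoPH_of ∕ _ofRunRows`, `k1R8_of_stubs`, `k1R9_of_stubs`; LINE 2∕2′'s W-END road
# `endStatementBPrinted_of_nodesPW_alongRuns_partialSums`, `endStatementBPrinted_window_of_recordSV_of_nodesW_of_runLetters` (+ `_of_nodes_`), `stabilityB_body_of_rung1VAt_of_runLetters`,
# `k1R9_of_stubsV`, `stabilityB_body_of_rung1VWAt_of_runLetters`, `k1R9_of_stubsVW` — every one takes the stub TEXTS as hypotheses and concludes the item's TEXT verbatim (not by name)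

R134 seat `pub-ymgap-dag-n24-c` (g23 pen, g24 re-stamp to v11.1), `--kind proof --supports stmt-QuantumFields-27239 --as helper` (count-neutral).  VERBATIM from the registered kit (namespace ↦ `…Theorems.K1AxV11Defs`, same as the Defs
mirror so every name reads as in the kit); nothing registered; superseded, not edited, on any v12 re-cut.

HONEST FRAMING.  Kernel bookkeeping over the mirrored definitions and the tree's END roads (dag-n24-w1 `…PartialSums` ∕ `…RunRemAt`, this seat's `…RunRemAtAx`, dag-n13-w4's window criterion);
hypothesis-form throughout — NO stub proved, nothing of Bałaban asserted; K1ᴬ OPEN (v11 0∕6); counts UNMOVED.  One finite 𝕋⁴ programme at fixed `ε` — NOT continuum ∕ ℝ⁴ ∕ OS ∕ mass gap ∕ Clay.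
No `sorry`; standard axioms.  Docstrings below are the kit's, VERBATIM.
-/

set_option autoImplicit false

noncomputable section

namespace Summit.QuantumFields.YangMills.Theorems.K1AxV11Defs

open Literature.MathematicalPhysics.QuantumFieldTheory.Balaban1983to89
open Literature.MathematicalPhysics.QuantumFieldTheory.Balaban1983to89.T4Continuum
open Literature.MathematicalPhysics.QuantumFieldTheory.Balaban1983to89.DagBinding

section RunRows

open FlowStepRuns
open FlowStep (HBeta RGEqH prefixOf)
open Summit.QuantumFields.YangMills.Theorems.BalabanUVNodesK2NamedJetsRunRemAt (RunConstRemainder)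
open Summit.QuantumFields.YangMills.BalabanUVNodes.K1EndOfNodes13PWSOfRunRemAtAx (stabilityB_body_of_rung1At_of_runLetters_Ax)  -- v11 (op 5b): (ii) the Ax END road
open Summit.QuantumFields.YangMills.Theorems.BalabanUVNodesK2NamedJetsRunRemAt (SurvCont)
open Summit.QuantumFields.YangMills.BalabanUVNodes.K1R9BodyAtRevisedRecordWorldOfNodesWRunLetters (endStatementBPrinted_of_nodesPW_alongRuns_partialSums)  -- v11.1 mirror: the kit's R1W lemma :545, landed (g12)

-- v11 (op 5b): v10's ADAPTER `runRowsAtSomeRecord13PWS_of_runRemAt_drift_match` (DEF-1's bundled `RunRemAt F κ θ h c`, whose remainder letter reads the CHOICE-centred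
-- `betaOfRecord₁₃`) is NOT carried at the re-centred record: its Ax edition awaits dag-lead HANDS-3 (v) (`RunRemAtAx`).  Not load-bearing (no stub ∕ composition read it); the run LETTERS it
-- would supply are exactly what `stub_runRows13PWS` displays.

/-- v5 ANNEX (hypothesis form, kernel-checked, no sorry; NOT the registered composition since v6): stub 1 → v5's rung 2 `BetaWindowAtSomeRecord13S` → K1, through the WORLD-LEVEL END
headline at the S-bound world (`endStatementBPrinted_of_recordS_of_nodes`) — the pointwise two-sided road stays a valid (stronger) supplier of the crux's consequent. -/
theorem StabilityBAtRecordR13SepCoPH_of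
    (h₁ : ∀ F : T4Family, Inhabited13 F → NodesAtSomeRecord13PWS F)
    (h₂ : ∀ F : T4Family, NodesAtSomeRecord13PWS F → BetaWindowAtSomeRecord13S F) :
    (∀ F : Literature.MathematicalPhysics.QuantumFieldTheory.Balaban1983to89.T4Continuum.T4Family, (∃ θ : Literature.MathematicalPhysics.QuantumFieldTheory.Balaban1983to89.Node00.Stage13HParams F 2, θ.Provisos₁₃SepCoPHAx F 2 ∧ (θ.ZhUnity F 2 ∧ θ.SlotsNondegenerate₁₃Ax F 2) ∧ θ.Admissible F 2) → ∃ (θ : Literature.MathematicalPhysics.QuantumFieldTheory.Balaban1983to89.Node00.Stage13HParams F 2) (h : θ.Provisos₁₃SepCoPHAx F 2), (θ.ZhUnity F 2 ∧ θ.SlotsNondegenerate₁₃Ax F 2) ∧ θ.Admissible F 2 ∧ Literature.MathematicalPhysics.QuantumFieldTheory.Balaban1983to89.B16.EndStatementBPrinted (Literature.MathematicalPhysics.QuantumFieldTheory.Balaban1983to89.Node00.datumOfRecord₁₃SepCoPHAx F 2 θ h).C ∧ ∃ γ₁ : ℝ, 0 < γ₁ ∧ ∀ γ : ℝ, 0 <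 γ → γ ≤ γ₁ → ∃ P : Literature.MathematicalPhysics.QuantumFieldTheory.Balaban1983to89.B12.RunParams, 1 ≤ P.K ∧ ((Literature.MathematicalPhysics.QuantumFieldTheory.Balaban1983to89.Node00.datumOfRecord₁₃SepCoPHAx F 2 θ h).C P).flow.InInterval γ P.K) := by
  intro F hinh
  obtain ⟨θ, h, w, hU, hθ, hR, hnodes, hβ, hwin⟩ := h₂ F (h₁ F hinh)
  exact ⟨θ, h, hU, hθ, endStatementBPrinted_of_recordS_of_nodes hR hnodes hβ, hwin⟩

/-- **THE COMPOSITION OF RECORD (v6; kernel-checked, no sorry): stub 1 → stub 2″ → K1⁷**, through dag-n24-w1 g2's θ-keyed run-letter END road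
`K1EndOfNodes13PWSOfRunRemAt.stabilityB_body_of_rung1At_of_runLetters` (p598782 §2: nodes + run-wise remainder + `b ≤ B` + match + run-wise (PS) floor ⊢ (B) at the datum AND the `K ≥ 1` window,
window re-lettered to `min (min w.γ γ₀) √(c₀∕(M+1))`; (0.20) guard by dag-n10-d's `rgFlow_of_smallCouplings_of_isRecordOfRecord₁₃CSepCoPHS`; END by p588006 §2; window by dag-n13-w4's
`window_of_frequently_beta_le`).  Concludes the item's text verbatim (not by name), so `_proof` below stays the skeleton audit's one candidate. -/
theorem StabilityBAtRecordR13SepCoPH_ofRunRows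
    (h₁ : ∀ F : T4Family, Inhabited13 F → NodesAtSomeRecord13PWS F)
    (h₂ : ∀ F : T4Family, NodesAtSomeRecord13PWS F → RunRowsAtSomeRecord13PWS F) :
    (∀ F : Literature.MathematicalPhysics.QuantumFieldTheory.Balaban1983to89.T4Continuum.T4Family, (∃ θ : Literature.MathematicalPhysics.QuantumFieldTheory.Balaban1983to89.Node00.Stage13HParams F 2, θ.Provisos₁₃SepCoPHAx F 2 ∧ (θ.ZhUnity F 2 ∧ θ.SlotsNondegenerate₁₃Ax F 2) ∧ θ.Admissible F 2) → ∃ (θ : Literature.MathematicalPhysics.QuantumFieldTheory.Balaban1983to89.Node00.Stage13HParams F 2) (h : θ.Provisos₁₃SepCoPHAx F 2), (θ.ZhUnity F 2 ∧ θ.SlotsNondegenerate₁₃Ax F 2) ∧ θ.Admissible F 2 ∧ Literature.MathematicalPhysics.QuantumFieldTheory.Balaban1983to89.B16.EndStatementBPrinted (Literature.MathematicalPhysics.QuantumFieldTheory.Balaban1983to89.Node00.datumOfRecord₁₃SepCoPHAx F 2 θ h).C ∧ ∃ γ₁ : ℝ, 0 < γ₁ ∧ ∀ γ : ℝ, 0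 < γ → γ ≤ γ₁ → ∃ P : Literature.MathematicalPhysics.QuantumFieldTheory.Balaban1983to89.B12.RunParams, 1 ≤ P.K ∧ ((Literature.MathematicalPhysics.QuantumFieldTheory.Balaban1983to89.Node00.datumOfRecord₁₃SepCoPHAx F 2 θ h).C P).flow.InInterval γ P.K) := by
  intro F hinh
  obtain ⟨θ, h, w, hU, hθ, hR, hnodes, b, r, γ₀, B, M, hγ₀, hrem, hB, hmatch, hps⟩ := h₂ F (h₁ F hinh)
  exact ⟨θ, h, stabilityB_body_of_rung1At_of_runLetters_Ax θ h w hU hθ hR hnodes hγ₀ hrem hB hmatch hps⟩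

/-- **COMPOSITION (kernel-checked, no sorry; = IDEA-4 g12 `k1R8_of_stubTexts_contExists`): K1⁸ FROM K1 v6's TWO REGISTERED STUB TEXTS VERBATIM + STUB 3.**  (B) + window at the rows∕(C)
witness by p598782 §2 `stabilityB_body_of_rung1At_of_runLetters` exactly as v6 composes K1⁷; rows (i)(iv) + (C) read off the bundle.  Concludes the item's TEXT verbatim (not by name;
v6 convention), so `_proof` below stays the skeleton audit's one candidate (ed.2′: ed.2 2d6d698fd0446e0a concluded by name and was bounced `skeleton.extra-hypothesis`). -/
theorem k1R8_of_stubs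
    (h₁ : ∀ F : T4Family, Inhabited13 F → NodesAtSomeRecord13PWS F)
    (h₂ : ∀ F : T4Family, NodesAtSomeRecord13PWS F → RunRowsAtSomeRecord13PWS F)
    (h₃ : ∀ F : T4Family, RunRowsAtSomeRecord13PWS F → RunRowsContAtSomeRecord13PWS F) :
    (∀ F : Literature.MathematicalPhysics.QuantumFieldTheory.Balaban1983to89.T4Continuum.T4Family, (∃ θ : Literature.MathematicalPhysics.QuantumFieldTheory.Balaban1983to89.Node00.Stage13HParams F 2, θ.Provisos₁₃SepCoPHAx F 2 ∧ (θ.ZhUnity F 2 ∧ θ.SlotsNondegenerate₁₃Ax F 2) ∧ θ.Admissible F 2) → ∃ (θ : Literature.MathematicalPhysics.QuantumFieldTheory.Balaban1983to89.Node00.Stage13HParams F 2) (h : θ.Provisos₁₃SepCoPHAx F 2), (θ.ZhUnity F 2 ∧ θ.SlotsNondegenerate₁₃Ax F 2) ∧ θ.Admissible F 2 ∧ Literature.MathematicalPhysics.QuantumFieldTheory.Balaban1983to89.B16.EndStatementBPrinted (Literature.MathematicalPhysics.QuantumFieldTheory.Balaban1983to89.Node00.datumOfRecord₁₃SepCoPHAx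 F 2 θ h).C ∧ (∃ γ₁ : ℝ, 0 < γ₁ ∧ ∀ γ : ℝ, 0 < γ → γ ≤ γ₁ → ∃ P : Literature.MathematicalPhysics.QuantumFieldTheory.Balaban1983to89.B12.RunParams, 1 ≤ P.K ∧ ((Literature.MathematicalPhysics.QuantumFieldTheory.Balaban1983to89.Node00.datumOfRecord₁₃SepCoPHAx F 2 θ h).C P).flow.InInterval γ P.K) ∧ ∃ (b : ℕ → ℝ) (r γ₀ M : ℝ), 0 < γ₀ ∧ (∀ (n : ℕ) (gs : ℕ → ℝ), Literature.MathematicalPhysics.QuantumFieldTheory.Balaban1983to89.FlowStep.RGEqH n (Literature.MathematicalPhysics.QuantumFieldTheory.Balaban1983to89.Node00.betaOfRecord₁₃Ax F 2 θ.toStage13Params) gs → Literature.MathematicalPhysics.QuantumFieldTheory.Balaban1983to89.Step.InInterval γ₀ n gs → ∀ k, k ≤ n → |Literature.MathematicalPhysics.QuantumFieldTheory.Balaban1983to89.Node00.betaOfRecord₁₃Ax F 2 θ.toStage13Params k (Literature.MathematicalPhysics.QuantumFieldTheory.Balaban1983to89.FlowStep.prefixOf gs k) - b k| ≤ r) ∧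 (∀ (n : ℕ) (gs : ℕ → ℝ), Literature.MathematicalPhysics.QuantumFieldTheory.Balaban1983to89.FlowStep.RGEqH n (Literature.MathematicalPhysics.QuantumFieldTheory.Balaban1983to89.Node00.betaOfRecord₁₃Ax F 2 θ.toStage13Params) gs → Literature.MathematicalPhysics.QuantumFieldTheory.Balaban1983to89.Step.InInterval γ₀ n gs → ∀ k, k ≤ n → -M ≤ ∑ j ∈ Finset.Ico k n, Literature.MathematicalPhysics.QuantumFieldTheory.Balaban1983to89.Node00.betaOfRecord₁₃Ax F 2 θ.toStage13Params j (Literature.MathematicalPhysics.QuantumFieldTheory.Balaban1983to89.FlowStep.prefixOf gs j)) ∧ ∀ k : ℕ, ContinuousOn (fun x : ℝ => Literature.MathematicalPhysics.QuantumFieldTheory.Balaban1983to89.Node00.betaOfRecord₁₃Ax F 2 θ.toStage13Params k (Literature.MathematicalPhysics.QuantumFieldTheory.Balaban1983to89.FlowStep.clampPrefix (Literature.MathematicalPhysics.QuantumFieldTheory.Balaban1983to89.Node00.betaOfRecord₁₃Ax F 2 θ.toStage13Params) γ₀ k x)) {x : ℝ | 0 < x ∧ x ≤ γ₀ ∧ ∀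 j, j ≤ k → 1 / γ₀ ^ 2 ≤ Literature.MathematicalPhysics.QuantumFieldTheory.Balaban1983to89.FlowStep.Y (Literature.MathematicalPhysics.QuantumFieldTheory.Balaban1983to89.Node00.betaOfRecord₁₃Ax F 2 θ.toStage13Params) γ₀ j x}) := by
  intro F hinh
  obtain ⟨θ, h, w, hU, hθ, hR, hnodes, b, r, γ₀, B, M, hγ₀, hrem, hB, hmatch, hps, hsc⟩ := h₃ F (h₂ F (h₁ F hinh))
  obtain ⟨hU', hθ', hb, hwin⟩ := stabilityB_body_of_rung1At_of_runLetters_Ax θ h w hU hθ hR hnodes hγ₀ hrem hB hmatch hps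
  exact ⟨θ, h, hU', hθ', hb, hwin, b, r, γ₀, M, hγ₀, hrem, hps, hsc⟩

-- v11 (op 5b): v7ᴿ's `StabilityBRunRowsAtRecordR13SepCoPH_proof` (K1⁸ BY NAME) is NOT carried — K1⁸ `StabilityBRunRowsAtRecordR13SepCoPH` (aside, proved) has no Ax twin; `k1R8_of_stubs` stays (LINE 1's K1ᴬ composition reads it).


/-! ## §R9 — rev 28 (plan g85 v8, director-ym №210 (δ)): K1⁹ = K1⁸ THROUGH THE DOOR -/

/-- **COMPOSITION (kernel-checked, no sorry): K1⁹ FROM v7ᴿ's THREE REGISTERED STUBS VERBATIM** — v7ᴿ's `k1R8_of_stubs` gives K1⁸'s body at a witness `(θ, h)`; present it at the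
TRIVIAL revision `Node00.Revision₁₃Ax.refl F 2 θ h`, transporting (B) and the window along the door `Node00.datumOfRecord₁₃SepCoPHVAx_refl` (`rfl`); rows (i)(iv)(C) are θ-level and pass
unchanged.  Concludes the item's TEXT verbatim (not by name), so `_proof` below is the skeleton audit's one candidate for K1⁹. -/
theorem k1R9_of_stubs
    (h₁ : ∀ F : T4Family, Inhabited13 F → NodesAtSomeRecord13PWS F)
    (h₂ : ∀ F : T4Family, NodesAtSomeRecord13PWS F → RunRowsAtSomeRecord13PWS F)
    (h₃ : ∀ F : T4Family, RunRowsAtSomeRecord13PWS F → RunRowsContAtSomeRecord13PWS F) :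
    (∀ F : Literature.MathematicalPhysics.QuantumFieldTheory.Balaban1983to89.T4Continuum.T4Family, (∃ θ : Literature.MathematicalPhysics.QuantumFieldTheory.Balaban1983to89.Node00.Stage13HParams F 2, θ.Provisos₁₃SepCoPHAx F 2 ∧ (θ.ZhUnity F 2 ∧ θ.SlotsNondegenerate₁₃Ax F 2) ∧ θ.Admissible F 2) → ∃ (θ : Literature.MathematicalPhysics.QuantumFieldTheory.Balaban1983to89.Node00.Stage13HParams F 2) (h : θ.Provisos₁₃SepCoPHAx F 2) (v : Literature.MathematicalPhysics.QuantumFieldTheory.Balaban1983to89.Node00.Revision₁₃Ax F 2 θ h), (θ.ZhUnity F 2 ∧ θ.SlotsNondegenerate₁₃Ax F 2) ∧ θ.Admissible F 2 ∧ Literature.MathematicalPhysics.QuantumFieldTheory.Balaban1983to89.B16.EndStatementBPrinted (Literature.MathematicalPhysics.QuantumFieldTheory.Balaban1983to89.Node00.datumOfRecord₁₃SepCoPHVAx F 2 θ h v).C ∧ (∃ γ₁ : ℝ, 0 < γ₁ ∧ ∀ γ : ℝ, 0 < γ → γ ≤ γ₁ → ∃ P : Literature.MathematicalPhysics.QuantumFieldTheory.Balaban1983to89.B12.RunParams,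 1 ≤ P.K ∧ ((Literature.MathematicalPhysics.QuantumFieldTheory.Balaban1983to89.Node00.datumOfRecord₁₃SepCoPHVAx F 2 θ h v).C P).flow.InInterval γ P.K) ∧ ∃ (b : ℕ → ℝ) (r γ₀ M : ℝ), 0 < γ₀ ∧ (∀ (n : ℕ) (gs : ℕ → ℝ), Literature.MathematicalPhysics.QuantumFieldTheory.Balaban1983to89.FlowStep.RGEqH n (Literature.MathematicalPhysics.QuantumFieldTheory.Balaban1983to89.Node00.betaOfRecord₁₃Ax F 2 θ.toStage13Params) gs → Literature.MathematicalPhysics.QuantumFieldTheory.Balaban1983to89.Step.InInterval γ₀ n gs → ∀ k, k ≤ n → |Literature.MathematicalPhysics.QuantumFieldTheory.Balaban1983to89.Node00.betaOfRecord₁₃Ax F 2 θ.toStage13Params k (Literature.MathematicalPhysics.QuantumFieldTheory.Balaban1983to89.FlowStep.prefixOf gs k) - b k| ≤ r) ∧ (∀ (n : ℕ) (gs : ℕ → ℝ), Literature.MathematicalPhysics.QuantumFieldTheory.Balaban1983to89.FlowStep.RGEqH n (Literature.MathematicalPhysics.QuantumFieldTheory.Balaban1983to89.Node00.betaOfRecord₁₃Ax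 F 2 θ.toStage13Params) gs → Literature.MathematicalPhysics.QuantumFieldTheory.Balaban1983to89.Step.InInterval γ₀ n gs → ∀ k, k ≤ n → -M ≤ ∑ j ∈ Finset.Ico k n, Literature.MathematicalPhysics.QuantumFieldTheory.Balaban1983to89.Node00.betaOfRecord₁₃Ax F 2 θ.toStage13Params j (Literature.MathematicalPhysics.QuantumFieldTheory.Balaban1983to89.FlowStep.prefixOf gs j)) ∧ ∀ k : ℕ, ContinuousOn (fun x : ℝ => Literature.MathematicalPhysics.QuantumFieldTheory.Balaban1983to89.Node00.betaOfRecord₁₃Ax F 2 θ.toStage13Params k (Literature.MathematicalPhysics.QuantumFieldTheory.Balaban1983to89.FlowStep.clampPrefix (Literature.MathematicalPhysics.QuantumFieldTheory.Balaban1983to89.Node00.betaOfRecord₁₃Ax F 2 θ.toStage13Params) γ₀ k x)) {x : ℝ | 0 < x ∧ x ≤ γ₀ ∧ ∀ j, j ≤ k → 1 / γ₀ ^ 2 ≤ Literature.MathematicalPhysics.QuantumFieldTheory.Balaban1983to89.FlowStep.Y (Literature.MathematicalPhysics.QuantumFieldTheory.Balaban1983to89.Node00.betaOfRecord₁₃Ax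 F 2 θ.toStage13Params) γ₀ j x}) := by
  intro F hinh
  obtain ⟨θ, h, hU', hθ', hb, hwin, hrows⟩ := k1R8_of_stubs h₁ h₂ h₃ F hinh
  have hv : Node00.datumOfRecord₁₃SepCoPHVAx F 2 θ h (Node00.Revision₁₃Ax.refl F 2 θ h) = Node00.datumOfRecord₁₃SepCoPHAx F 2 θ h :=
    Node00.datumOfRecord₁₃SepCoPHVAx_refl F 2 θ h
  exact ⟨θ, h, Node00.Revision₁₃Ax.refl F 2 θ h, hU', hθ', by rw [hv]; exact hb, by rw [hv]; exact hwin, hrows⟩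

-- v11.1 mirror: the kit's `endStatementBPrinted_of_nodesPW_alongRuns_partialSums` (:545–:555) IS this seat's g12 lemma of the same name and statement in
-- `…K1R9BodyAtRevisedRecordWorldOfNodesWRunLetters` (K1⁹ v10's W-END road) — cited by `open` above, not restated (gate `dedup.landed`).

/-- **★ THE W-END ROAD (LINE 2′'s kernel glue; no sorry; R1W: nodes WINDOW-GUARDED): END + WINDOW AT THE REVISED RECORD DATUM FROM THE NODES AT AN `RecordSⱽ` WORLD AND THE RUN LETTERS ONLY.**  = dag-n24-w1 g2 p598782 §2's
D-keyed headline `endStatementBPrinted_window_of_isRecordOfRecord₁₃CSepCoPHS_of_nodes_of_runLetters` ported to `D := Node00.datumOfRecord₁₃SepCoPHVAx F 2 θ h v`: `M ≥ 0` from the one-point run;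
`c₀ := 1 − (1+w.β₀)⁻²`; window re-lettered to `γ₁ := min (min w.γ γ₀) √(c₀∕(M+1))`; the (0.20) guard at the re-lettered REVISED world is the guard at its RECORD-REBOUND TWIN (an S-class record at
the datum of record: `Node00.rgFlow_of_smallCouplings_of_isRecordOfRecord₁₃CSepCoPHS`) transported along `leavesP_revision₁₃_eq_update` (n13-w3 g4: the `smallCouplings`∕`rgFlow` leaves are
version-blind); run letters by p598782 §1 at `D.curries`; END by PartialSums §2 at the world; window by dag-n13-w4's `window_of_frequently_beta_le` (the revised datum's `βfun` IS `betaOfRecord₁₃Ax θ`,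
`rfl`).  CONDITIONAL on its displayed hypotheses; nothing of Bałaban asserted; K1⁹ NOT closed.
[cite: Balaban1989LargeFieldII, Thm 1 p.355 + (0.1) pp.355–356 + p.391; Balaban1988Convergent, (2.6) p.255, Cor. 3 (2.50) p.264; Balaban1987RG1, (0.17)–(0.20) pp.255–256, Thm 2 p.259, (1.22) p.264, Thm 3 p.264] -/
theorem endStatementBPrinted_window_of_recordSV_of_nodesW_of_runLetters {F : T4Family} {θ : Node00.Stage13HParams F 2} {h : θ.Provisos₁₃SepCoPHAx F 2}
    {v : Node00.Revision₁₃Ax F 2 θ h} {w : WorldP} (hRV : RecordSV F θ h v w) (hnodes : ∀ P : B12.RunParams, (leavesP w P).smallCouplings → Nodes (leavesP w P))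
    {b : ℕ → ℝ} {r γ₀ B M : ℝ} (hγ₀ : 0 < γ₀) (hrem : RunConstRemainder (Node00.betaOfRecord₁₃Ax F 2 θ.toStage13Params) b r γ₀) (hB : ∀ k, b k ≤ B) (hmatch : B + r ≤ w.βup)
    (hps : ∀ (n : ℕ) (gs : ℕ → ℝ), RGEqH n (Node00.betaOfRecord₁₃Ax F 2 θ.toStage13Params) gs → Step.InInterval γ₀ n gs →
      ∀ k, k ≤ n → -M ≤ ∑ j ∈ Finset.Ico k n, Node00.betaOfRecord₁₃Ax F 2 θ.toStage13Params j (prefixOf gs j)) :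
    B16.EndStatementBPrinted (Node00.datumOfRecord₁₃SepCoPHVAx F 2 θ h v).C ∧
      ∃ γ₁ : ℝ, 0 < γ₁ ∧ ∀ γ : ℝ, 0 < γ → γ ≤ γ₁ → ∃ P : B12.RunParams, 1 ≤ P.K ∧ ((Node00.datumOfRecord₁₃SepCoPHVAx F 2 θ h v).C P).flow.InInterval γ P.K := by
  obtain ⟨θ', h', hθ', hDD, hC, hγ, hL, hup⟩ := hRV
  have hγw : 0 < w.γ := hγ.1
  -- the revised datum, its run letters in `D.βfun` currency (DEF-1's `rfl` face `βfun_datumOfRecord₁₃SepCoPHVAx`)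
  have hremD : RunConstRemainder (Node00.datumOfRecord₁₃SepCoPHVAx F 2 θ h v).βfun b r γ₀ := hrem
  have hpsD : ∀ (n : ℕ) (gs : ℕ → ℝ), RGEqH n (Node00.datumOfRecord₁₃SepCoPHVAx F 2 θ h v).βfun gs → Step.InInterval γ₀ n gs →
      ∀ k, k ≤ n → -M ≤ ∑ j ∈ Finset.Ico k n, (Node00.datumOfRecord₁₃SepCoPHVAx F 2 θ h v).βfun j (prefixOf gs j) := hps
  -- M ≥ 0 from the empty sum along the one-point run `(γ₀)`
  have hM : 0 ≤ M := by
    have hRG : RGEqH 0 (Node00.betaOfRecord₁₃Ax F 2 θ.toStage13Params) (fun _ => γ₀) := fun k hk => absurd hk (Nat.not_lt_zero k)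
    have hI : Step.InInterval γ₀ 0 (fun _ => γ₀) := fun _ _ => ⟨hγ₀, le_rfl⟩
    have h0 := hps 0 (fun _ => γ₀) hRG hI 0 le_rfl
    simp only [Finset.Ico_self, Finset.sum_empty] at h0
    linarith
  -- the smallness constant and the shrunk window
  set c₀ : ℝ := 1 - ((1 + w.β₀) ^ 2)⁻¹ with hc₀_def
  have hc₀ : 0 < c₀ := by
    have h1 : 1 < (1 + w.β₀) ^ 2 := by nlinarith [w.β₀_pos]
    have h2 : ((1 + w.β₀) ^ 2)⁻¹ < 1 := inv_lt_one_of_one_lt₀ h1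
    rw [hc₀_def]; linarith
  set γM : ℝ := Real.sqrt (c₀ / (M + 1)) with hγM_def
  have hγM : 0 < γM := Real.sqrt_pos.mpr (by positivity)
  set γ₁ : ℝ := min (min w.γ γ₀) γM with hγ₁_def
  have hγ₁ : 0 < γ₁ := lt_min (lt_min hγw hγ₀) hγM
  have hγ₁w : γ₁ ≤ w.γ := (min_le_left _ _).trans (min_le_left _ _)
  have hγ₁₀ : γ₁ ≤ γ₀ := (min_le_left _ _).trans (min_le_right _ _)
  have hsmall : M * γ₁ ^ 2 ≤ c₀ := by
    have h1 : γ₁ ^ 2 ≤ γM ^ 2 := pow_le_pow_left₀ hγ₁.le (min_le_right _ _) 2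
    have h2 : γM ^ 2 = c₀ / (M + 1) := by rw [hγM_def, Real.sq_sqrt (by positivity)]
    have h3 : M * (c₀ / (M + 1)) ≤ c₀ := by
      rw [mul_div_assoc']
      rw [div_le_iff₀ (by positivity)]
      nlinarith [hc₀, hM]
    calc M * γ₁ ^ 2 ≤ M * γM ^ 2 := mul_le_mul_of_nonneg_left h1 hM
      _ = M * (c₀ / (M + 1)) := by rw [h2]
      _ ≤ c₀ := h3
  -- the re-lettered REVISED world `w'` and the (0.20) guard at it, transported from its record-rebound twin (an S-class record at the datum of record)
  have hrgV : ∀ P : B12.RunParams, (leavesP ({ w with γ := γ₁, b := w.b, b_pos := w.b_pos } : WorldP) P).smallCouplings →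
      (leavesP ({ w with γ := γ₁, b := w.b, b_pos := w.b_pos } : WorldP) P).rgFlow := by
    intro P hsc
    have e := Summit.QuantumFields.YangMills.BalabanUVNodes.N13NodeAtRevisedRecordWorldAtRecord13SepCoPHVAx.leavesP_revision₁₃Ax_eq_update F 2 θ h v
      ({ w with γ := γ₁, b := w.b, b_pos := w.b_pos } : WorldP) P hC
    have hR0 : Node00.IsRecordOfRecord₁₃CSepCoPHSAx F 2 (Node00.datumOfRecord₁₃SepCoPHAx F 2 θ h)
        { ({ w with γ := γ₁, b := w.b, b_pos := w.b_pos } : WorldP) with C := (Node00.datumOfRecord₁₃SepCoPHAx F 2 θ h).C } :=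
      ⟨θ', h', hθ', hDD, rfl, ⟨hγ₁, hγ₁w.trans hγ.2⟩, hL, hup⟩
    have hsc0 : (leavesP { ({ w with γ := γ₁, b := w.b, b_pos := w.b_pos } : WorldP) with C := (Node00.datumOfRecord₁₃SepCoPHAx F 2 θ h).C } P).smallCouplings := by
      rw [e] at hsc; exact hsc
    have hrg0 := Node00.rgFlow_of_smallCouplings_of_isRecordOfRecord₁₃CSepCoPHSAx hR0 P hsc0
    rw [e]; exact hrg0
  -- END along runs at the re-lettered revised world (p588006 ∕ PartialSums §2), run letters by p598782 §1 at `D.curries`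
  have hEND : B16.EndStatementBPrinted ({ w with γ := γ₁, b := w.b, b_pos := w.b_pos } : WorldP).C := by
    -- R1W: END along runs from the WINDOW-GUARDED nodes — `Dag.UVStability4D ℓ := ℓ.smallCouplings → …` reads the nodes only inside the window
    refine endStatementBPrinted_of_nodesPW_alongRuns_partialSums
      { w with γ := γ₁, b := w.b, b_pos := w.b_pos } hγ₁ (M := M)
      (fun P hsc => Summit.QuantumFields.YangMills.BalabanUVNodes.K1BetaWindow13SOfNodes13PWSOfBoxH.nodes_leavesP_reletter_of_le w hγ₁w w.b_pos P
        (hnodes P (fun k hk => ⟨(hsc k hk).1, (hsc k hk).2.trans hγ₁w⟩)))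
      hrgV (fun P hsc => ?_) (fun P hsc => ?_) hsmall
    · have hrgP : ((Node00.datumOfRecord₁₃SepCoPHVAx F 2 θ h v).C.toB12 P).flow.SatisfiesRG P.K := by
        have h' := hrgV P hsc
        show ((Node00.datumOfRecord₁₃SepCoPHVAx F 2 θ h v).C P).flow.SatisfiesRG P.K
        rw [← hC]; exact h'
      have hsc' : ((Node00.datumOfRecord₁₃SepCoPHVAx F 2 θ h v).C.toB12 P).flow.InInterval γ₁ P.K := by
        show ((Node00.datumOfRecord₁₃SepCoPHVAx F 2 θ h v).C P).flow.InInterval γ₁ P.K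
        rw [← hC]; exact hsc
      show ∀ j, j < P.K → (w.C P).flow.β (j + 1) ((w.C P).flow.g j) ≤ w.βup
      rw [hC]
      exact fun j hj => (Summit.QuantumFields.YangMills.BalabanUVNodes.K1EndOfNodes13PWSOfRunRemAt.upper_alongRun_of_runConstRemainder
        (Node00.datumOfRecord₁₃SepCoPHVAx F 2 θ h v).C.toB12 (Node00.datumOfRecord₁₃SepCoPHVAx F 2 θ h v).βfun (Node00.datumOfRecord₁₃SepCoPHVAx F 2 θ h v).curries
        hγ₁₀ hremD hB P hrgP hsc' j hj).trans hmatch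
    · have hrgP : ((Node00.datumOfRecord₁₃SepCoPHVAx F 2 θ h v).C.toB12 P).flow.SatisfiesRG P.K := by
        have h' := hrgV P hsc
        show ((Node00.datumOfRecord₁₃SepCoPHVAx F 2 θ h v).C P).flow.SatisfiesRG P.K
        rw [← hC]; exact h'
      have hsc' : ((Node00.datumOfRecord₁₃SepCoPHVAx F 2 θ h v).C.toB12 P).flow.InInterval γ₁ P.K := by
        show ((Node00.datumOfRecord₁₃SepCoPHVAx F 2 θ h v).C P).flow.InInterval γ₁ P.K
        rw [← hC]; exact hsc
      show ∀ m n, m ≤ n → n ≤ P.K → -M ≤ ∑ j ∈ Finset.Ico m n, (w.C P).flow.β (j + 1) ((w.C P).flow.g j)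
      rw [hC]
      exact Summit.QuantumFields.YangMills.BalabanUVNodes.K1EndOfNodes13PWSOfRunRemAt.partialSums_alongRun_of_runwisePS
        (Node00.datumOfRecord₁₃SepCoPHVAx F 2 θ h v).C.toB12 (Node00.datumOfRecord₁₃SepCoPHVAx F 2 θ h v).βfun (Node00.datumOfRecord₁₃SepCoPHVAx F 2 θ h v).curries
        hγ₁₀ hpsD P hrgP hsc'
  refine ⟨?_, Summit.QuantumFields.YangMills.Theorems.BalabanUVNodesK1WindowExactCriterion.window_of_frequently_beta_le (Node00.datumOfRecord₁₃SepCoPHVAx F 2 θ h v)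
    (Summit.QuantumFields.YangMills.BalabanUVNodes.K1EndOfNodes13PWSOfRunRemAt.frequently_betaZero_le_of_runConstRemainder hγ₀ hremD)⟩
  have : ({ w with γ := γ₁, b := w.b, b_pos := w.b_pos } : WorldP).C = (Node00.datumOfRecord₁₃SepCoPHVAx F 2 θ h v).C := hC
  rw [← this]
  exact hEND

/-- The V-END road of the registered v9 (nodes at EVERY run) is the W-END road's corollary (forget the guard). -/
theorem endStatementBPrinted_window_of_recordSV_of_nodes_of_runLetters {F : T4Family} {θ : Node00.Stage13HParams F 2} {h : θ.Provisos₁₃SepCoPHAx F 2}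
    {v : Node00.Revision₁₃Ax F 2 θ h} {w : WorldP} (hRV : RecordSV F θ h v w) (hnodes : ∀ P : B12.RunParams, Nodes (leavesP w P))
    {b : ℕ → ℝ} {r γ₀ B M : ℝ} (hγ₀ : 0 < γ₀) (hrem : RunConstRemainder (Node00.betaOfRecord₁₃Ax F 2 θ.toStage13Params) b r γ₀) (hB : ∀ k, b k ≤ B) (hmatch : B + r ≤ w.βup)
    (hps : ∀ (n : ℕ) (gs : ℕ → ℝ), RGEqH n (Node00.betaOfRecord₁₃Ax F 2 θ.toStage13Params) gs → Step.InInterval γ₀ n gs →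
      ∀ k, k ≤ n → -M ≤ ∑ j ∈ Finset.Ico k n, Node00.betaOfRecord₁₃Ax F 2 θ.toStage13Params j (prefixOf gs j)) :
    B16.EndStatementBPrinted (Node00.datumOfRecord₁₃SepCoPHVAx F 2 θ h v).C ∧
      ∃ γ₁ : ℝ, 0 < γ₁ ∧ ∀ γ : ℝ, 0 < γ → γ ≤ γ₁ → ∃ P : B12.RunParams, 1 ≤ P.K ∧ ((Node00.datumOfRecord₁₃SepCoPHVAx F 2 θ h v).C P).flow.InInterval γ P.K :=
  endStatementBPrinted_window_of_recordSV_of_nodesW_of_runLetters hRV (fun P _ => hnodes P) hγ₀ hrem hB hmatch hps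

/-- **★ LINE 2's CONSEQUENT AT THE WITNESS** (θ∕v-keyed wrapper of the V-END road): unity ∧ slots, admissibility, an `RecordSⱽ` world with the thirteen nodes, the run letters ⊢ K1⁹'s body at `(θ, h, v)`
minus the rows (which the composition re-attaches).  CONDITIONAL; closes nothing. [cite: Balaban1989LargeFieldII, Thm 1 p.355 + (0.1) pp.355–356 (bookkeeping)] -/
theorem stabilityB_body_of_rung1VAt_of_runLetters {F : T4Family} (θ : Node00.Stage13HParams F 2) (h : θ.Provisos₁₃SepCoPHAx F 2) (v : Node00.Revision₁₃Ax F 2 θ h) (w : WorldP)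
    (hU : θ.ZhUnity F 2 ∧ θ.SlotsNondegenerate₁₃Ax F 2) (hθ : θ.Admissible F 2) (hR : RecordSV F θ h v w) (hnodes : ∀ P : B12.RunParams, Nodes (leavesP w P))
    {b : ℕ → ℝ} {r γ₀ B M : ℝ} (hγ₀ : 0 < γ₀) (hrem : RunConstRemainder (Node00.betaOfRecord₁₃Ax F 2 θ.toStage13Params) b r γ₀) (hB : ∀ k, b k ≤ B) (hmatch : B + r ≤ w.βup)
    (hps : ∀ (n : ℕ) (gs : ℕ → ℝ), RGEqH n (Node00.betaOfRecord₁₃Ax F 2 θ.toStage13Params) gs → Step.InInterval γ₀ n gs →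
      ∀ k, k ≤ n → -M ≤ ∑ j ∈ Finset.Ico k n, Node00.betaOfRecord₁₃Ax F 2 θ.toStage13Params j (prefixOf gs j)) :
    (θ.ZhUnity F 2 ∧ θ.SlotsNondegenerate₁₃Ax F 2) ∧ θ.Admissible F 2 ∧ B16.EndStatementBPrinted (Node00.datumOfRecord₁₃SepCoPHVAx F 2 θ h v).C ∧
      ∃ γ₁ : ℝ, 0 < γ₁ ∧ ∀ γ : ℝ, 0 < γ → γ ≤ γ₁ → ∃ P : B12.RunParams, 1 ≤ P.K ∧ ((Node00.datumOfRecord₁₃SepCoPHVAx F 2 θ h v).C P).flow.InInterval γ P.K :=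
  ⟨hU, hθ, endStatementBPrinted_window_of_recordSV_of_nodes_of_runLetters hR hnodes hγ₀ hrem hB hmatch hps⟩

/-- **COMPOSITION (LINE 2; kernel-checked, no sorry): K1⁹ FROM THE THREE V-STUBS**, the slot filled by the WITNESS's OWN revision `v` (not `refl`): (B) at `(datumOfRecord₁₃SepCoPHVAx θ h v).C` and the
window by the V-END road; rows (i)(iv)(C) read off the rung.  Concludes the item's TEXT verbatim; `_proof` below restates it as the ROUTE DECL BY NAME. -/
theorem k1R9_of_stubsV
    (h₁ : ∀ F : T4Family, Inhabited13 F → NodesAtSomeRecord13PWSV F)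
    (h₂ : ∀ F : T4Family, NodesAtSomeRecord13PWSV F → RunRowsAtSomeRecord13PWSV F)
    (h₃ : ∀ F : T4Family, RunRowsAtSomeRecord13PWSV F → RunRowsContAtSomeRecord13PWSV F) :
    (∀ F : Literature.MathematicalPhysics.QuantumFieldTheory.Balaban1983to89.T4Continuum.T4Family, (∃ θ : Literature.MathematicalPhysics.QuantumFieldTheory.Balaban1983to89.Node00.Stage13HParams F 2, θ.Provisos₁₃SepCoPHAx F 2 ∧ (θ.ZhUnity F 2 ∧ θ.SlotsNondegenerate₁₃Ax F 2) ∧ θ.Admissible F 2) → ∃ (θ : Literature.MathematicalPhysics.QuantumFieldTheory.Balaban1983to89.Node00.Stage13HParams F 2) (h : θ.Provisos₁₃SepCoPHAx F 2) (v : Literature.MathematicalPhysics.QuantumFieldTheory.Balaban1983to89.Node00.Revision₁₃Ax F 2 θ h), (θ.ZhUnity F 2 ∧ θ.SlotsNondegenerate₁₃Ax F 2) ∧ θ.Admissible F 2 ∧ Literature.MathematicalPhysics.QuantumFieldTheory.Balaban1983to89.B16.EndStatementBPrinted (Literature.MathematicalPhysics.QuantumFieldTheory.Balaban1983to89.Node00.datumOfRecord₁₃SepCoPHVAx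 F 2 θ h v).C ∧ (∃ γ₁ : ℝ, 0 < γ₁ ∧ ∀ γ : ℝ, 0 < γ → γ ≤ γ₁ → ∃ P : Literature.MathematicalPhysics.QuantumFieldTheory.Balaban1983to89.B12.RunParams, 1 ≤ P.K ∧ ((Literature.MathematicalPhysics.QuantumFieldTheory.Balaban1983to89.Node00.datumOfRecord₁₃SepCoPHVAx F 2 θ h v).C P).flow.InInterval γ P.K) ∧ ∃ (b : ℕ → ℝ) (r γ₀ M : ℝ), 0 < γ₀ ∧ (∀ (n : ℕ) (gs : ℕ → ℝ), Literature.MathematicalPhysics.QuantumFieldTheory.Balaban1983to89.FlowStep.RGEqH n (Literature.MathematicalPhysics.QuantumFieldTheory.Balaban1983to89.Node00.betaOfRecord₁₃Ax F 2 θ.toStage13Params) gs → Literature.MathematicalPhysics.QuantumFieldTheory.Balaban1983to89.Step.InInterval γ₀ n gs → ∀ k, k ≤ n → |Literature.MathematicalPhysics.QuantumFieldTheory.Balaban1983to89.Node00.betaOfRecord₁₃Ax F 2 θ.toStage13Params k (Literature.MathematicalPhysics.QuantumFieldTheory.Balaban1983to89.FlowStep.prefixOf gs k) - b k| ≤ r)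 ∧ (∀ (n : ℕ) (gs : ℕ → ℝ), Literature.MathematicalPhysics.QuantumFieldTheory.Balaban1983to89.FlowStep.RGEqH n (Literature.MathematicalPhysics.QuantumFieldTheory.Balaban1983to89.Node00.betaOfRecord₁₃Ax F 2 θ.toStage13Params) gs → Literature.MathematicalPhysics.QuantumFieldTheory.Balaban1983to89.Step.InInterval γ₀ n gs → ∀ k, k ≤ n → -M ≤ ∑ j ∈ Finset.Ico k n, Literature.MathematicalPhysics.QuantumFieldTheory.Balaban1983to89.Node00.betaOfRecord₁₃Ax F 2 θ.toStage13Params j (Literature.MathematicalPhysics.QuantumFieldTheory.Balaban1983to89.FlowStep.prefixOf gs j)) ∧ ∀ k : ℕ, ContinuousOn (fun x : ℝ => Literature.MathematicalPhysics.QuantumFieldTheory.Balaban1983to89.Node00.betaOfRecord₁₃Ax F 2 θ.toStage13Params k (Literature.MathematicalPhysics.QuantumFieldTheory.Balaban1983to89.FlowStep.clampPrefix (Literature.MathematicalPhysics.QuantumFieldTheory.Balaban1983to89.Node00.betaOfRecord₁₃Ax F 2 θ.toStage13Params) γ₀ k x)) {x : ℝ | 0 < x ∧ x ≤ γ₀ ∧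 ∀ j, j ≤ k → 1 / γ₀ ^ 2 ≤ Literature.MathematicalPhysics.QuantumFieldTheory.Balaban1983to89.FlowStep.Y (Literature.MathematicalPhysics.QuantumFieldTheory.Balaban1983to89.Node00.betaOfRecord₁₃Ax F 2 θ.toStage13Params) γ₀ j x}) := by
  intro F hinh
  obtain ⟨θ, h, v, w, hU, hθ, hR, hnodes, b, r, γ₀, B, M, hγ₀, hrem, hB, hmatch, hps, hsc⟩ := h₃ F (h₂ F (h₁ F hinh))
  obtain ⟨hb, hwin⟩ := endStatementBPrinted_window_of_recordSV_of_nodes_of_runLetters hR hnodes hγ₀ hrem hB hmatch hps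
  exact ⟨θ, h, v, hU, hθ, hb, hwin, b, r, γ₀, M, hγ₀, hrem, hps, hsc⟩

/-- **R1W: LINE 2′'s CONSEQUENT AT THE WITNESS** from WINDOW-GUARDED nodes (the W-END road). CONDITIONAL; closes nothing. -/
theorem stabilityB_body_of_rung1VWAt_of_runLetters {F : T4Family} (θ : Node00.Stage13HParams F 2) (h : θ.Provisos₁₃SepCoPHAx F 2) (v : Node00.Revision₁₃Ax F 2 θ h) (w : WorldP)
    (hU : θ.ZhUnity F 2 ∧ θ.SlotsNondegenerate₁₃Ax F 2) (hθ : θ.Admissible F 2) (hR : RecordSV F θ h v w) (hnodes : ∀ P : B12.RunParams, (leavesP w P).smallCouplings → Nodes (leavesP w P))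
    {b : ℕ → ℝ} {r γ₀ B M : ℝ} (hγ₀ : 0 < γ₀) (hrem : RunConstRemainder (Node00.betaOfRecord₁₃Ax F 2 θ.toStage13Params) b r γ₀) (hB : ∀ k, b k ≤ B) (hmatch : B + r ≤ w.βup)
    (hps : ∀ (n : ℕ) (gs : ℕ → ℝ), RGEqH n (Node00.betaOfRecord₁₃Ax F 2 θ.toStage13Params) gs → Step.InInterval γ₀ n gs →
      ∀ k, k ≤ n → -M ≤ ∑ j ∈ Finset.Ico k n, Node00.betaOfRecord₁₃Ax F 2 θ.toStage13Params j (prefixOf gs j)) :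
    (θ.ZhUnity F 2 ∧ θ.SlotsNondegenerate₁₃Ax F 2) ∧ θ.Admissible F 2 ∧ B16.EndStatementBPrinted (Node00.datumOfRecord₁₃SepCoPHVAx F 2 θ h v).C ∧
      ∃ γ₁ : ℝ, 0 < γ₁ ∧ ∀ γ : ℝ, 0 < γ → γ ≤ γ₁ → ∃ P : B12.RunParams, 1 ≤ P.K ∧ ((Node00.datumOfRecord₁₃SepCoPHVAx F 2 θ h v).C P).flow.InInterval γ P.K :=
  ⟨hU, hθ, endStatementBPrinted_window_of_recordSV_of_nodesW_of_runLetters hR hnodes hγ₀ hrem hB hmatch hps⟩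

/-- **R1W COMPOSITION (LINE 2′; kernel-checked, no sorry): K1⁹ FROM THE THREE VW-STUBS** — the item's TEXT verbatim. -/
theorem k1R9_of_stubsVW
    (h₁ : ∀ F : T4Family, Inhabited13 F → NodesAtSomeRecord13PWSVW F)
    (h₂ : ∀ F : T4Family, NodesAtSomeRecord13PWSVW F → RunRowsAtSomeRecord13PWSVW F)
    (h₃ : ∀ F : T4Family, RunRowsAtSomeRecord13PWSVW F → RunRowsContAtSomeRecord13PWSVW F) :
    (∀ F : Literature.MathematicalPhysics.QuantumFieldTheory.Balaban1983to89.T4Continuum.T4Family, (∃ θ : Literature.MathematicalPhysics.QuantumFieldTheory.Balaban1983to89.Node00.Stage13HParams F 2, θ.Provisos₁₃SepCoPHAx F 2 ∧ (θ.ZhUnity F 2 ∧ θ.SlotsNondegenerate₁₃Ax F 2) ∧ θ.Admissible F 2) → ∃ (θ : Literature.MathematicalPhysics.QuantumFieldTheory.Balaban1983to89.Node00.Stage13HParams F 2) (h : θ.Provisos₁₃SepCoPHAx F 2) (v : Literature.MathematicalPhysics.QuantumFieldTheory.Balaban1983to89.Node00.Revision₁₃Ax F 2 θ h), (θ.ZhUnity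 F 2 ∧ θ.SlotsNondegenerate₁₃Ax F 2) ∧ θ.Admissible F 2 ∧ Literature.MathematicalPhysics.QuantumFieldTheory.Balaban1983to89.B16.EndStatementBPrinted (Literature.MathematicalPhysics.QuantumFieldTheory.Balaban1983to89.Node00.datumOfRecord₁₃SepCoPHVAx F 2 θ h v).C ∧ (∃ γ₁ : ℝ, 0 < γ₁ ∧ ∀ γ : ℝ, 0 < γ → γ ≤ γ₁ → ∃ P : Literature.MathematicalPhysics.QuantumFieldTheory.Balaban1983to89.B12.RunParams, 1 ≤ P.K ∧ ((Literature.MathematicalPhysics.QuantumFieldTheory.Balaban1983to89.Node00.datumOfRecord₁₃SepCoPHVAx F 2 θ h v).C P).flow.InInterval γ P.K) ∧ ∃ (b : ℕ → ℝ) (r γ₀ M : ℝ), 0 < γ₀ ∧ (∀ (n : ℕ) (gs : ℕ → ℝ), Literature.MathematicalPhysics.QuantumFieldTheory.Balaban1983to89.FlowStep.RGEqH n (Literature.MathematicalPhysics.QuantumFieldTheory.Balaban1983to89.Node00.betaOfRecord₁₃Ax F 2 θ.toStage13Params) gs → Literature.MathematicalPhysics.QuantumFieldTheory.Balaban1983to89.Step.InInterval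 γ₀ n gs → ∀ k, k ≤ n → |Literature.MathematicalPhysics.QuantumFieldTheory.Balaban1983to89.Node00.betaOfRecord₁₃Ax F 2 θ.toStage13Params k (Literature.MathematicalPhysics.QuantumFieldTheory.Balaban1983to89.FlowStep.prefixOf gs k) - b k| ≤ r) ∧ (∀ (n : ℕ) (gs : ℕ → ℝ), Literature.MathematicalPhysics.QuantumFieldTheory.Balaban1983to89.FlowStep.RGEqH n (Literature.MathematicalPhysics.QuantumFieldTheory.Balaban1983to89.Node00.betaOfRecord₁₃Ax F 2 θ.toStage13Params) gs → Literature.MathematicalPhysics.QuantumFieldTheory.Balaban1983to89.Step.InInterval γ₀ n gs → ∀ k, k ≤ n → -M ≤ ∑ j ∈ Finset.Ico k n, Literature.MathematicalPhysics.QuantumFieldTheory.Balaban1983to89.Node00.betaOfRecord₁₃Ax F 2 θ.toStage13Params j (Literature.MathematicalPhysics.QuantumFieldTheory.Balaban1983to89.FlowStep.prefixOf gs j)) ∧ ∀ k : ℕ, ContinuousOn (fun x : ℝ => Literature.MathematicalPhysics.QuantumFieldTheory.Balaban1983to89.Node00.betaOfRecord₁₃Ax F 2 θ.toStage13Params k (Literature.MathematicalPhysics.QuantumFieldTheory.Balaban1983to89.FlowStep.clampPrefix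 (Literature.MathematicalPhysics.QuantumFieldTheory.Balaban1983to89.Node00.betaOfRecord₁₃Ax F 2 θ.toStage13Params) γ₀ k x)) {x : ℝ | 0 < x ∧ x ≤ γ₀ ∧ ∀ j, j ≤ k → 1 / γ₀ ^ 2 ≤ Literature.MathematicalPhysics.QuantumFieldTheory.Balaban1983to89.FlowStep.Y (Literature.MathematicalPhysics.QuantumFieldTheory.Balaban1983to89.Node00.betaOfRecord₁₃Ax F 2 θ.toStage13Params) γ₀ j x}) := by
  intro F hinh
  obtain ⟨θ, h, v, w, hU, hθ, hR, hnodes, b, r, γ₀, B, M, hγ₀, hrem, hB, hmatch, hps, hsc⟩ := h₃ F (h₂ F (h₁ F hinh))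
  obtain ⟨hb, hwin⟩ := endStatementBPrinted_window_of_recordSV_of_nodesW_of_runLetters hR hnodes hγ₀ hrem hB hmatch hps
  exact ⟨θ, h, v, hU, hθ, hb, hwin, b, r, γ₀, M, hγ₀, hrem, hps, hsc⟩

end RunRows

end Summit.QuantumFields.YangMills.Theorems.K1AxV11Defs

end
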